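import Mathlib
import Literature.Analysis.FluidPDE.Tao2016AveragedNS.LocalCascadeSolutions
import HarnessLib

/-!
# Re-entry rescaling adapter and datum evaluation for box certificates (route `BarrierStepRungThree`)

Supports items stmt-NavierStokesRegularity-23420 / 23648 / 23942.  Two of the box clauses of the
certificate template (`taoLadderRungThree_target_of_boxCertificateKit`, file
`…CertificateTemplate.lean`) are not yet polynomial inequalities as stated:

* the GOAL clause asks, at a goal state `S` with `a := |S_{i₀,1}| ≥ 2^{-θ}`, for the RESCALED shifted
  window `y / a` (`y_{i,j} = S_{i,1+kLo+j}`) to satisfy `v (y / a) ≤ 0` and `0 < g (y / a)` — a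
  rational, not polynomial, condition in `(y, a)`;
* the DATUM clauses evaluate `v`, `g` at the window of the rescaled one-shell datum
  `datumState i₀ X₀`.

This currency-free file turns both into what a rational SOS certificate proves.  RESCALING: if the
certificate writer supplies a homogeneous decomposition of the clock, `v (t • y) = ∑_{m ≤ d} t^m v_m(y)`
(for an explicit polynomial `v` this is an identity closed by `ring`/`simp`, whatever the polynomial
currency), then `v (y / a) ≤ 0` follows from the POLYNOMIAL inequality `∑_{m ≤ d} a^{d-m} v_m(y) ≤ 0` and
`0 < g (y / a)` from `0 < ∑_{m ≤ d} a^{d-m} g_m(y)` (`a > 0`; multiply by `a^d`):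
`le_zero_of_rescaled`, `pos_of_rescaled`, and the packaged `reentry_of_homogeneous` in the exact shape
of the template's `hgoal` conclusion.  DATUM: `datum_window` computes the window of the datum
(`X₀ i / |X₀ i₀|` on the shell `j` with `kLo + j = 0`, zero elsewhere).

HONEST FRAMING: elementary algebra for CHECKING a certificate about a Tao-type MODEL lattice (rung
TL-M3); nothing here concerns the Navier–Stokes equations; no summit is proved by this file.
-/

noncomputable section

-- the sub-problem namespace repeats the summit name by design (D-0017)
set_option linter.dupNamespace false

namespace Summit.NavierStokesRegularity.NavierStokesRegularity.Theorems

namespace CertificateProfile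

open scoped BigOperators
open Literature.Analysis.FluidPDE Literature.Analysis.FluidPDE.TaoCascade

variable {n : ℕ}

/-- **Rescaling identity.** If `v (t • y) = ∑_{m ≤ d} t^m v_m(y)` for all `t`, then for `a ≠ 0`
`a^d · v (y / a) = ∑_{m ≤ d} a^{d-m} v_m(y)`. [folklore] -/
theorem pow_mul_apply_div_eq {v : (Fin 4 → Fin n → ℝ) → ℝ} {d : ℕ}
    {vm : ℕ → (Fin 4 → Fin n → ℝ) → ℝ}
    (hhom : ∀ (y : Fin 4 → Fin n → ℝ) (t : ℝ),
      v (fun i j => t * y i j) = ∑ m ∈ Finset.range (d + 1), t ^ m * vm m y)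
    (y : Fin 4 → Fin n → ℝ) {a : ℝ} (ha : a ≠ 0) :
    a ^ d * v (fun i j => y i j / a) = ∑ m ∈ Finset.range (d + 1), a ^ (d - m) * vm m y := by
  have h := hhom y a⁻¹
  have e : (fun i j => a⁻¹ * y i j) = fun i j => y i j / a := by
    funext i j; rw [div_eq_inv_mul]
  rw [e] at h
  rw [h, Finset.mul_sum]
  refine Finset.sum_congr rfl fun m hm => ?_
  have hmd : m ≤ d := Nat.lt_succ_iff.1 (Finset.mem_range.1 hm)
  rw [← mul_assoc, inv_pow, ← div_eq_mul_inv, pow_sub₀ a ha hmd, div_eq_mul_inv]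

/-- **Re-entry, clock part.** From the homogeneous decomposition of `v` and the polynomial
inequality `∑_{m ≤ d} a^{d-m} v_m(y) ≤ 0` at `a > 0`: `v (y / a) ≤ 0`. [folklore] -/
theorem le_zero_of_rescaled {v : (Fin 4 → Fin n → ℝ) → ℝ} {d : ℕ}
    {vm : ℕ → (Fin 4 → Fin n → ℝ) → ℝ}
    (hhom : ∀ (y : Fin 4 → Fin n → ℝ) (t : ℝ),
      v (fun i j => t * y i j) = ∑ m ∈ Finset.range (d + 1), t ^ m * vm m y)
    {y : Fin 4 → Fin n → ℝ} {a : ℝ} (ha : 0 < a)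
    (h : ∑ m ∈ Finset.range (d + 1), a ^ (d - m) * vm m y ≤ 0) :
    v (fun i j => y i j / a) ≤ 0 := by
  have key := pow_mul_apply_div_eq hhom y ha.ne'
  have had : 0 < a ^ d := pow_pos ha d
  have h1 : a ^ d * v (fun i j => y i j / a) ≤ 0 := by rw [key]; exact h
  exact le_of_not_gt fun hcon => absurd h1 (not_le.2 (mul_pos had hcon))

/-- **Re-entry, goal part.** From the homogeneous decomposition of `g` and the polynomial
inequality `0 < ∑_{m ≤ d} a^{d-m} g_m(y)` at `a > 0`: `0 < g (y / a)`. [folklore] -/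
theorem pos_of_rescaled {g : (Fin 4 → Fin n → ℝ) → ℝ} {d : ℕ}
    {gm : ℕ → (Fin 4 → Fin n → ℝ) → ℝ}
    (hhom : ∀ (y : Fin 4 → Fin n → ℝ) (t : ℝ),
      g (fun i j => t * y i j) = ∑ m ∈ Finset.range (d + 1), t ^ m * gm m y)
    {y : Fin 4 → Fin n → ℝ} {a : ℝ} (ha : 0 < a)
    (h : 0 < ∑ m ∈ Finset.range (d + 1), a ^ (d - m) * gm m y) :
    0 < g (fun i j => y i j / a) := by
  have key := pow_mul_apply_div_eq hhom y ha.ne'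
  have had : 0 < a ^ d := pow_pos ha d
  rw [← key] at h
  exact pos_of_mul_pos_right h had.le

/-- **The re-entry conjuncts of the template's GOAL clause from polynomial inequalities.** Let `v`, `g`
have homogeneous decompositions of degrees `≤ d`, `≤ d'` (`hv`, `hg`).  At a lattice state `S` with
`2^{-θ} ≤ |S_{i₀,1}|`, if the rescaled polynomial inequalities hold for the shifted window
`y_{i,j} = S_{i,1+kLo+j}` with `a = |S_{i₀,1}|` — `∑ a^{d-m} v_m(y) ≤ 0` and `0 < ∑ a^{d'-m} g_m(y)` —
then the shifted rescaled window re-enters: `v (y/a) ≤ 0 ∧ 0 < g (y/a)`, in the exact shape of the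
conclusion of `hgoal` in `taoLadderRungThree_target_of_boxCertificateKit`.  (A certificate proves the
two polynomial inequalities on the goal face of the box with the side conditions `a ≥ 2^{-θ}`,
`a² = S_{i₀,1}²`.) [cite: Tao2016AveragedNS, §6.2 Prop. 6.3 (vi)–(ix) (re-entry after rescaling by
the ratio `a ≥ (1+ε₀)^{-θ}`)] -/
theorem reentry_of_homogeneous {kLo : ℤ} {θ : ℝ} {i₀ : Fin 4} {v g : (Fin 4 → Fin n → ℝ) → ℝ}
    {d d' : ℕ} {vm gm : ℕ → (Fin 4 → Fin n → ℝ) → ℝ}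
    (hv : ∀ (y : Fin 4 → Fin n → ℝ) (t : ℝ),
      v (fun i j => t * y i j) = ∑ m ∈ Finset.range (d + 1), t ^ m * vm m y)
    (hg : ∀ (y : Fin 4 → Fin n → ℝ) (t : ℝ),
      g (fun i j => t * y i j) = ∑ m ∈ Finset.range (d' + 1), t ^ m * gm m y)
    (S : Fin 4 → ℤ → ℝ) (ha : (1 + 1 : ℝ) ^ (-θ) ≤ |S i₀ 1|)
    (hvy : ∑ m ∈ Finset.range (d + 1),
      |S i₀ 1| ^ (d - m) * vm m (fun i (j : Fin n) => S i (1 + (kLo + (j : ℕ)))) ≤ 0)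
    (hgy : 0 < ∑ m ∈ Finset.range (d' + 1),
      |S i₀ 1| ^ (d' - m) * gm m (fun i (j : Fin n) => S i (1 + (kLo + (j : ℕ))))) :
    v (fun i (j : Fin n) => S i (1 + (kLo + (j : ℕ))) / |S i₀ 1|) ≤ 0 ∧
      0 < g (fun i (j : Fin n) => S i (1 + (kLo + (j : ℕ))) / |S i₀ 1|) := by
  have h2 : (0 : ℝ) < (1 + 1 : ℝ) ^ (-θ) := Real.rpow_pos_of_pos (by norm_num) _
  have hapos : 0 < |S i₀ 1| := lt_of_lt_of_le h2 ha
  exact ⟨le_zero_of_rescaled hv hapos hvy, pos_of_rescaled hg hapos hgy⟩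

/-- **The goal threshold from a squared inequality**: `2^{-2θ} ≤ S_{i₀,1}²` gives
`2^{-θ} ≤ |S_{i₀,1}|` (the first conjunct of the template's `hgoal` conclusion, polynomial form).
[folklore] -/
theorem threshold_of_sq {θ : ℝ} {s : ℝ} (h : ((1 + 1 : ℝ) ^ (-θ)) ^ 2 ≤ s ^ 2) :
    (1 + 1 : ℝ) ^ (-θ) ≤ |s| := by
  have h2 : (0 : ℝ) ≤ (1 + 1 : ℝ) ^ (-θ) := (Real.rpow_pos_of_pos (by norm_num) _).le
  have h3 := sq_le_sq.1 h
  rwa [abs_of_nonneg h2] at h3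

/-- **The window of the rescaled one-shell datum.** On the window `[kLo, kLo+n)` the datum
`datumState i₀ X₀` reads `X₀ i / |X₀ i₀|` at the shell `j` with `kLo + j = 0` and `0` elsewhere — the
point at which the datum clauses `v ≤ 0 < g` of the template are to be evaluated.
[cite: Tao2016AveragedNS, §6.2 (6.9)–(6.10) and §4 (4.7) (the one-shell datum)] -/
theorem datum_window (kLo : ℤ) (i₀ : Fin 4) (X₀ : Fin 4 → ℝ) :
    (fun (i : Fin 4) (j : Fin n) => datumState i₀ X₀ i (kLo + (j : ℕ))) =
      fun (i : Fin 4) (j : Fin n) => if kLo + (j : ℕ) = 0 then X₀ i / |X₀ i₀| else 0 := by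
  funext i j
  rw [datumState_apply]
  split_ifs <;> simp

end CertificateProfile

end Summit.NavierStokesRegularity.NavierStokesRegularity.Theorems

end
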